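import Mathlib
import Summits.Ventures.PercRepro2.Defs
import Summits.Ventures.PercRepro2.Independence
import Summits.Ventures.PercRepro2.Graph
import Summits.Ventures.PercRepro2.Induced
import Summits.Ventures.PercRepro2.HullDefs
import Summits.Ventures.PercRepro2.HullFlip
import Summits.Ventures.PercRepro2.HullTheoremA

/-!
# The core-trivial part of a hull fibre, and the per-hull (BASE) on trees
(blind cell PercRepro2, typer-1; lead g10 `LEAD-PROOFSHAPES.md` ADDENDUM 24 (25)–(27), asks
2026-08-23T08:19:14Z and 08:24:26Z)

* `hullTerm H` = `Σ_{ζ : H_l(ζ) = H} s_{o,l}(ζ) · 1[h ∉ H_l] · 1[h ↔_B b]`, the per-hull term of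
  (BASE) on the free fibre, and `coreTrivialTerm H` = the same sum restricted to `{core = {l}}`;
* **`coreTrivial_sum_nonneg`** (ADDENDUM 24 (27)): the core-trivial part of EVERY hull fibre is
  nonnegative — the pairing argument of Theorem B (`sum_sideSign_mul_nonneg_core`) with the fibre
  indicator `1[H_l = H]` folded into `φ`, which the flip of the piece of `o` preserves (`hull_flipO`);
* `IsForest ends`: no two edges of `ends` have the same endpoints and the graph of all edges is
  acyclic; **`core_eq_singleton_of_isForest`**: on a forest the core of every two-colouring is `{l}`
  (a red path and a blue path from `l` to `k ≠ l` would be two paths of an acyclic graph, hence equal,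
  but their common first edge cannot be both red and blue);
* **`Tree.hullTerm_nonneg`** (ADDENDUM 24 (25)): on a forest every per-hull term of (BASE) is
  nonnegative; corollary `Tree.sum_sideSign_outConn_nonneg` = (BASE) on the free fibre of a forest.
-/

namespace Summit.Ventures.PercRepro2

namespace Hull

open scoped Classical

variable {V : Type*} {E : Type*}

/-! ## The per-hull terms -/

section PerHull

variable [Fintype E] [DecidableEq E] {R : Type*} [Field R] [LinearOrder R] [IsStrictOrderedRing R]

/-- The per-hull term of (BASE) on the free fibre:
`Σ_{ζ : H_l(ζ) = H} s_{o,l}(ζ) · 1[h ∉ H_l] · 1[h ↔_B b]`. -/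
noncomputable def hullTerm (R : Type*) [Ring R] (ends : E → Sym2 V) (l o h b : V) (H : Set V) : R :=
  ∑ ζ : Config E, if hull ends ζ l = H then sideSign R ends ζ l o * outConn R ends l h b ζ else 0

/-- The core-trivial part of the hull fibre of `H`:
`Σ_{ζ : H_l(ζ) = H, core = {l}} s_{o,l}(ζ) · 1[h ∉ H_l] · 1[h ↔_B b]`. -/
noncomputable def coreTrivialTerm (R : Type*) [Ring R] (ends : E → Sym2 V) (l o h b : V)
    (H : Set V) : R :=
  ∑ ζ : Config E, if hull ends ζ l = H ∧ core ends ζ l = {l} then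
    sideSign R ends ζ l o * outConn R ends l h b ζ else 0

omit [LinearOrder R] [IsStrictOrderedRing R] in
/-- The per-hull terms sum to the free-fibre hull sum `Σ_ζ s_{o,l} · outConn`. -/
lemma sum_hullTerm (ends : E → Sym2 V) (l o h b : V) [Fintype V] :
    ∑ H : Set V, hullTerm R ends l o h b H =
      ∑ ζ : Config E, sideSign R ends ζ l o * outConn R ends l h b ζ := by
  unfold hullTerm
  rw [Finset.sum_comm]
  refine Finset.sum_congr rfl fun ζ _ => ?_
  rw [Finset.sum_ite_eq Finset.univ (hull ends ζ l), if_pos (Finset.mem_univ _)]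

/-- **ADDENDUM 24 (27)**: the core-trivial part of every hull fibre is nonnegative:
`Σ_{ζ : H_l = H, core = {l}} s_{o,l}(ζ) · 1[h ∉ H_l] · 1[h ↔_B b] ≥ 0`. The swap of the side
component of `o` (the flip of its piece) is an involution of the sub-fibre exchanging the two sides,
preserving the hull and the core, under which `1[h ↔_B b]` can only drop in the direction
red → blue. -/
theorem coreTrivial_sum_nonneg (ends : E → Sym2 V) (l o h b : V) (H : Set V) :
    0 ≤ coreTrivialTerm R ends l o h b H := by
  unfold coreTrivialTerm
  have key := sum_sideSign_mul_nonneg_core (R := R) ends l o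
    (fun ζ => (if hull ends ζ l = H then 1 else 0) * outConn R ends l h b ζ)
    (fun ζ hR hnc => by
      rw [(flipO_red hR hnc).2.2.2.1]
      exact mul_le_mul_of_nonneg_left (outConn_flipO_le h b hR hnc) (by split_ifs <;> norm_num))
  refine key.trans (le_of_eq (Finset.sum_congr rfl fun ζ _ => ?_))
  by_cases hK : core ends ζ l = {l} <;> by_cases hH : hull ends ζ l = H <;> simp [hK, hH]

end PerHull

/-! ## Forests: the core is always `{l}` -/

section Forest

variable {ends : E → Sym2 V}

/-- `ends` is a forest: no two edges have the same endpoints (no parallel edges) and the simple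
graph of all edges is acyclic. (Loops are harmless for connectivity and are not excluded.) -/
def IsForest (ends : E → Sym2 V) : Prop :=
  Function.Injective ends ∧ (openGraph ends (fun _ => true)).IsAcyclic

/-- Every configuration is below the all-open one. -/
lemma le_allOpen (ω : Config E) : ω ≤ fun _ => true := fun _ => Bool.le_true _

/-- The second vertex of a walk is unchanged by `mapLe` (stated with the endpoints of the
supergraph walk syntactically equal to those of the original walk). -/
lemma getVert_one_mapLe {G G' : SimpleGraph V} (hle : G ≤ G') {u v : V} (p : G.Walk u v) :
    (p.mapLe hle).getVert 1 = p.getVert 1 := by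
  cases p with
  | nil => rfl
  | cons hadj q =>
    simp only [SimpleGraph.Walk.mapLe, SimpleGraph.Walk.map_cons, SimpleGraph.Walk.getVert_cons_succ,
      SimpleGraph.Walk.getVert_zero, SimpleGraph.Hom.coe_ofLE, id]

/-- On a forest a vertex red-connected AND blue-connected to `l` is `l` itself: the red path and
the blue path from `l` to `k` are both paths of the acyclic graph of all edges, hence equal, and
their common first edge `e` would have to be red and blue at once. -/
lemma eq_of_conn_of_conn_blue (hF : IsForest ends) {ζ : Config E} {l k : V}
    (hR : Conn ends ζ l k) (hB : Conn ends (blue ζ) l k) : k = l := by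
  by_contra hne
  have hlk : l ≠ k := fun h => hne h.symm
  obtain ⟨wr⟩ := hR
  obtain ⟨wb⟩ := hB
  have hleR : openGraph ends ζ ≤ openGraph ends (fun _ => true) :=
    openGraph_mono (le_allOpen ζ)
  have hleB : openGraph ends (blue ζ) ≤ openGraph ends (fun _ => true) :=
    openGraph_mono (le_allOpen (blue ζ))
  set pr : (openGraph ends ζ).Path l k := wr.toPath with hpr
  set pb : (openGraph ends (blue ζ)).Path l k := wb.toPath with hpb
  have huniq := hF.2.path_unique
    ⟨pr.1.mapLe hleR, (SimpleGraph.Walk.isPath_mapLe hleR).2 pr.2⟩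
    ⟨pb.1.mapLe hleB, (SimpleGraph.Walk.isPath_mapLe hleB).2 pb.2⟩
  have hval : pr.1.mapLe hleR = pb.1.mapLe hleB := congrArg Subtype.val huniq
  have hsnd : pr.1.getVert 1 = pb.1.getVert 1 := by
    have h1 := congrArg (fun w : (openGraph ends (fun _ => true)).Walk l k => w.getVert 1) hval
    simpa only [getVert_one_mapLe] using h1
  have hadjR : (openGraph ends ζ).Adj l (pr.1.getVert 1) :=
    SimpleGraph.Walk.adj_snd (SimpleGraph.Walk.not_nil_of_ne hlk)
  have hadjB : (openGraph ends (blue ζ)).Adj l (pb.1.getVert 1) :=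
    SimpleGraph.Walk.adj_snd (SimpleGraph.Walk.not_nil_of_ne hlk)
  rw [← hsnd] at hadjB
  obtain ⟨_, e, he, hends⟩ := openGraph_adj.1 hadjR
  obtain ⟨_, e', he', hends'⟩ := openGraph_adj.1 hadjB
  have hee : e = e' := hF.1 (hends.trans hends'.symm)
  subst hee
  rw [blue_eq_true_iff] at he'
  rw [he] at he'
  exact Bool.noConfusion he'

/-- **On a forest the core of every two-colouring is `{l}`.** -/
theorem core_eq_singleton_of_isForest (hF : IsForest ends) (ζ : Config E) (l : V) :
    core ends ζ l = {l} := by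
  ext k
  constructor
  · intro hk
    exact eq_of_conn_of_conn_blue hF hk.1 hk.2
  · intro hk
    rw [Set.mem_singleton_iff] at hk
    subst hk
    exact l_mem_core ζ k

/-- On a forest `o` lies on a side of the hull iff it lies in the hull and is not `l`. -/
lemma mem_rside_or_bside_of_isForest (hF : IsForest ends) {ζ : Config E} {l o : V}
    (ho : o ∈ hull ends ζ l) (hne : o ≠ l) : o ∈ rside ends ζ l ∨ o ∈ bside ends ζ l := by
  refine mem_rside_or_bside_of_mem_hull_sdiff_core ⟨ho, fun hK => hne ?_⟩
  rw [core_eq_singleton_of_isForest hF] at hK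
  exact hK

end Forest

/-! ## The per-hull (BASE) on trees -/

namespace Tree

variable [Fintype E] [DecidableEq E] {R : Type*} [Field R] [LinearOrder R] [IsStrictOrderedRing R]
  {ends : E → Sym2 V}

omit [LinearOrder R] [IsStrictOrderedRing R] in
/-- On a forest the per-hull term is its core-trivial part. -/
lemma hullTerm_eq_coreTrivialTerm (hF : IsForest ends) (l o h b : V) (H : Set V) :
    hullTerm R ends l o h b H = coreTrivialTerm R ends l o h b H := by
  unfold hullTerm coreTrivialTerm
  refine Finset.sum_congr rfl fun ζ _ => ?_
  rw [core_eq_singleton_of_isForest hF ζ l]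
  simp only [and_true]

/-- **ADDENDUM 24 (25) — the per-hull (BASE) on trees**: for a forest `ends`, every marking
`(l, o, h, b)` and every vertex set `H`,
`Σ_{ζ : H_l(ζ) = H} s_{o,l}(ζ) · 1[h ∉ H_l] · 1[h ↔_B b] ≥ 0`. On a forest the core is `{l}` for
every colouring (`core_eq_singleton_of_isForest`), so every branch of the hull at `l` is
monochromatic and the swap of the branch of `o` pairs the fibre (`coreTrivial_sum_nonneg`). -/
theorem hullTerm_nonneg (hF : IsForest ends) (l o h b : V) (H : Set V) :
    0 ≤ hullTerm R ends l o h b H := by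
  rw [hullTerm_eq_coreTrivialTerm hF]
  exact coreTrivial_sum_nonneg ends l o h b H

/-- (BASE) on the free fibre of a forest: `Σ_ζ s_{o,l}(ζ) · 1[h ∉ H_l] · 1[h ↔_B b] ≥ 0`
(Theorem B, since the core is always `{l}`). -/
theorem sum_sideSign_outConn_nonneg (hF : IsForest ends) (l o h b : V) :
    0 ≤ ∑ ζ : Config E, sideSign R ends ζ l o * outConn R ends l h b ζ := by
  refine (thmB_conn (R := R) ends l o h b).trans (le_of_eq (Finset.sum_congr rfl fun ζ _ => ?_))
  rw [if_pos (core_eq_singleton_of_isForest hF ζ l)]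

/-- (HULL-OUT) on the free fibre of a forest: `Σ_ζ s_{o,l} · 1[v, w ∉ H_l] · 1[v ↔_B w] ≥ 0`. -/
theorem sum_sideSign_outConn₂_nonneg (hF : IsForest ends) (l o v w : V) :
    0 ≤ ∑ ζ : Config E, sideSign R ends ζ l o * outConn₂ R ends l v w ζ := by
  refine (thmB_conn_out (R := R) ends l o v w).trans
    (le_of_eq (Finset.sum_congr rfl fun ζ _ => ?_))
  rw [if_pos (core_eq_singleton_of_isForest hF ζ l)]

end Tree

end Hull

end Summit.Ventures.PercRepro2
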